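import Summits.QuantumFields.BalabanUV.T4Continuum.Support.NE4TransferResolvent

/-!
# NE4TransferResolventWitness — NON-VACUITY and NON-DEGENERACY of the resolvent route's binder list (file 3 of the route;
# cell `pub-balaban`, BINDER-OWNERS row NE4, co-owner #3, lineage `b2b-balaban-t4-ne4-p3`, generation 1)

HONEST FRAMING.  A TOY over `𝔅 = 𝔸 = ℝ`, nothing of Bałaban's: it shows that the seven leaves of `Support/NE4TransferModel` (file 1)
are JOINTLY satisfiable by a history-dependent family with a genuinely LINEAR, genuinely age-weighted transfer (`C_W = 1`, age
factor `ω ∈ ]0,1[`), a genuinely Lipschitz activity → value step (`C_F = ε > 0`), a non-zero one-step η-source (`s(1 − ρ)ρ^k`),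
the printed one-loop split with the VANISHING of β¹ at `g_k = 0`, and the window `ν = ω + ε < 1` — so that the END faces of file 2
(`ne4Triple_of_model`, `injectedRate_of_model`) quantify over an inhabited, non-degenerate class (referee criterion (g3); compare the
row owner's `T4BetaReadOutWitness` for the P1 faces and row NE5's `toyModel`s).  NOT Bałaban's β, NOT NE4, NOT summit progress; rung
(B)+1 context only; NOT infinite volume, NOT a mass gap, NOT Clay.

THE TOY.  Transfer `W k c E = Σ_{j<k} ω^{k−1−j}E_j` (the youngest old bracket undamped, as in [II] p. 8); new bracket
`N k c a = c + sρ^k + εa`; read-out `r k c a = c·(1 + εa + sρ^k)` (vanishes at `c = 0`); stored brackets in CLOSED FORM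
`B k w = w_k + sρ^k + ε·A k w`, `A k w = Σ_{i<k} (ω+ε)^{k−1−i}(w_i + sρ^i)` — the closed form IS the Neumann series of the weighted
shift (`acc_transfer_eq`: `Σ_{j<k} ω^{k−1−j}B_j = Σ_{i<k} ν^{k−1−i}(w_i + sρ^i)`, `ν = ω + ε`), which is exactly what `Represents` /
`ReadsRemainder` demand.  All constants explicit: `C_W = 1`, `C_F = ε`, `C_r = γε`, `ℓ′ = 1`, `ℓ = 1 + εE₀/(1 − ω) + s`,
`E₀ = (γ + s)(1 + ε/(1 − ν))`, `b = s(1 − ρ)`, `b_r = γs(1 − ρ)`.  [folklore] throughout; no `sorry`.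
v1.1 (APPEND-ONLY over v1 p207264): §5 — the rate `ν = ω + ε` is ATTAINED at the level of β (`toyBeta_update`,
`toy_moduli_lower`: `Λ k i ≥ γεν^{k−1−i}` for ANY history moduli of the toy's β, `toy_not_fadingMemory_below`: none below `ν`).
-/

noncomputable section

open scoped BigOperators
open Finset

namespace Summit.QuantumFields.BalabanUV.T4Continuum.NE4TransferResolventWitness

open Literature.MathematicalPhysics.QuantumFieldTheory.Balaban1983to89
open Literature.MathematicalPhysics.QuantumFieldTheory.Balaban1983to89.FlowStep
open Literature.MathematicalPhysics.QuantumFieldTheory.Balaban1983to89.T4CouplingMatching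
open Literature.MathematicalPhysics.QuantumFieldTheory.Balaban1983to89.T4BetaMemorySharp (acc acc_zero acc_succ)
open Literature.MathematicalPhysics.QuantumFieldTheory.Balaban1983to89.T4OutputRate (Window mem_window)
open Summit.QuantumFields.BalabanUV.T4Continuum.NE4TransferModel
open Summit.QuantumFields.BalabanUV.T4Continuum.NE4TransferModel.StepTransferModel
open Summit.QuantumFields.BalabanUV.T4Continuum.NE4TransferResolvent

/-! ## §1 The toy data -/

/-- The toy's closed-form ACTIVITY along a history `w = (w₀,…,w_k)`: `A k w = Σ_{i<k} ν^{k−1−i}(w_i + sρ^i)`, `ν = ω + ε` —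
the Neumann series of the weighted shift, written out. [folklore] -/
def toyA (ω ε s ρ : ℝ) (k : ℕ) (w : Fin (k + 1) → ℝ) : ℝ :=
  ∑ i : Fin k, (ω + ε) ^ (k - 1 - (i : ℕ)) * (w (Fin.castSucc i) + s * ρ ^ (i : ℕ))

/-- The toy's stored bracket born at step `k`: `w_k + sρ^k + ε·A k w`. [folklore] -/
def toyB (ω ε s ρ : ℝ) (k : ℕ) (w : Fin (k + 1) → ℝ) : ℝ :=
  w (Fin.last k) + s * ρ ^ k + ε * toyA ω ε s ρ k w

/-- The toy's LINEAR transfer: `E ↦ Σ_{j<k} ω^{k−1−j}E_j` (a sum of coordinate projections). [folklore] -/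
def toyW (ω : ℝ) (k : ℕ) : (Fin k → ℝ) →ₗ[ℝ] ℝ :=
  ∑ j : Fin k, (ω ^ (k - 1 - (j : ℕ))) • (LinearMap.proj j : (Fin k → ℝ) →ₗ[ℝ] ℝ)

/-- Evaluation of the toy transfer. [folklore] -/
@[simp] theorem toyW_apply (ω : ℝ) (k : ℕ) (E : Fin k → ℝ) :
    toyW ω k E = ∑ j : Fin k, ω ^ (k - 1 - (j : ℕ)) * E j := by
  simp [toyW, LinearMap.sum_apply, smul_eq_mul]

/-- THE TOY MODEL over `𝔅 = 𝔸 = ℝ`: transfer `toyW`, new bracket `c + sρ^k + εa`, read-out `c(1 + εa + sρ^k)`, brackets `toyB`. [folklore] -/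
def toyModel (ω ε s ρ : ℝ) : StepTransferModel ℝ ℝ where
  W := fun k _ => toyW ω k
  N := fun k c a => c + s * ρ ^ k + ε * a
  r := fun k c a => c * (1 + ε * a + s * ρ ^ k)
  B := toyB ω ε s ρ

/-- The toy's history-dependent β-family with the printed one-loop split: `β k w = (binf + c₀θ^k) + w_k·(1 + ε·A k w + sρ^k)`;
the remainder VANISHES at `w_k = 0`. [folklore] -/
def toyBeta (ω ε s ρ binf c₀ θ : ℝ) : HBeta := fun k w => (binf + c₀ * θ ^ k) + w (Fin.last k) * (1 + ε * toyA ω ε s ρ k w + s * ρ ^ k)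

/-- The toy's `B12Beta.OneLoopSplit`. [folklore] -/
def toySplit (ω ε s ρ binf c₀ θ : ℝ) : B12Beta.OneLoopSplit (toyBeta ω ε s ρ binf c₀ θ) where
  β0 := fun k => binf + c₀ * θ ^ k
  β1 := fun k w => w (Fin.last k) * (1 + ε * toyA ω ε s ρ k w + s * ρ ^ k)
  split := fun _ _ => rfl
  vanish := fun k p hp => by simp [hp]

/-! ## §2 The Neumann-series identity behind `Represents` -/

/-- Along a sequence `g`, the toy activity at depth `k` is the `ν`-accumulated forcing `f i = g i + sρ^i`. [folklore] -/
theorem toyA_prefixOf (ω ε s ρ : ℝ) (k : ℕ) (g : ℕ → ℝ) :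
    toyA ω ε s ρ k (prefixOf g k) = acc (ω + ε) (fun i => g i + s * ρ ^ i) k := by
  unfold toyA acc
  rw [← Fin.sum_univ_eq_sum_range (fun i => (ω + ε) ^ (k - 1 - i) * (g i + s * ρ ^ i)) k]
  simp [prefixOf]

/-- THE NEUMANN-SERIES IDENTITY: the `ω`-weighted transfer of the toy's older brackets equals the `ν`-accumulated forcing,
`Σ_{j<k} ω^{k−1−j}·B j (g₀..g_j) = Σ_{i<k} ν^{k−1−i}(g_i + sρ^i)`, `ν = ω + ε` (induction with `acc_succ`). [folklore] -/
theorem acc_transfer_eq (ω ε s ρ : ℝ) (g : ℕ → ℝ) :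
    ∀ k, acc ω (fun j => toyB ω ε s ρ j (prefixOf g j)) k = acc (ω + ε) (fun i => g i + s * ρ ^ i) k := by
  intro k
  induction k with
  | zero => simp [acc_zero]
  | succ k ih =>
    rw [acc_succ, acc_succ, ih]
    simp only [toyB, toyA_prefixOf, prefixOf_apply, Fin.val_last]
    ring

/-- The transfer of the older family along `g`, in closed form. [folklore] -/
theorem toy_act (ω ε s ρ : ℝ) (k : ℕ) (g : ℕ → ℝ) (c : ℝ) :
    (toyModel ω ε s ρ).W k c ((toyModel ω ε s ρ).older k g) = acc (ω + ε) (fun i => g i + s * ρ ^ i) k := by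
  rw [← acc_transfer_eq]
  show toyW ω k _ = _
  rw [toyW_apply, ← sum_fin_weight_eq_acc]
  rfl

/-! ## §3 The seven leaves hold (explicit constants) -/

section Leaves

variable {ω ε s ρ γ : ℝ}

/-- L1 `Represents` for the toy (the orbit identity = the Neumann-series identity). [folklore] -/
theorem toy_represents (ω ε s ρ γ : ℝ) : (toyModel ω ε s ρ).Represents γ := by
  intro k g _
  show toyB ω ε s ρ k (prefixOf g k) = g k + s * ρ ^ k + ε * (toyModel ω ε s ρ).W k (g k) ((toyModel ω ε s ρ).older k g)
  rw [toy_act]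
  simp [toyB, toyA_prefixOf, prefixOf]

/-- L2 `ReadsRemainder` for the toy split. [folklore] -/
theorem toy_readsRemainder (ω ε s ρ γ binf c₀ θ : ℝ) :
    (toyModel ω ε s ρ).ReadsRemainder (toySplit ω ε s ρ binf c₀ θ) γ := by
  intro k g _
  show prefixOf g k (Fin.last k) * (1 + ε * toyA ω ε s ρ k (prefixOf g k) + s * ρ ^ k)
    = g k * (1 + ε * (toyModel ω ε s ρ).W k (g k) ((toyModel ω ε s ρ).older k g) + s * ρ ^ k)
  rw [toy_act, toyA_prefixOf]
  simp [prefixOf]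

/-- L3 `TransferBound` with `C_W = 1` (for `ω ≥ 0`). [folklore] -/
theorem toy_transferBound (hω : 0 ≤ ω) (γ : ℝ) : (toyModel ω ε s ρ).TransferBound 1 ω γ := by
  intro k c E _ _
  show |toyW ω k E| ≤ _
  rw [toyW_apply, one_mul, ← Real.norm_eq_abs]
  refine (norm_sum_le _ _).trans (le_of_eq ?_)
  refine Finset.sum_congr rfl fun j _ => ?_
  rw [norm_mul, Real.norm_eq_abs, Real.norm_eq_abs, abs_of_nonneg (pow_nonneg hω _)]

/-- L4 `ActivityLipschitz` with `C_F = ε`, `C_r = γε` (for `ε ≥ 0`). [folklore] -/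
theorem toy_activityLipschitz (hε : 0 ≤ ε) (E₀ : ℝ) : (toyModel ω ε s ρ).ActivityLipschitz ε (γ * ε) E₀ γ := by
  intro k c E E' hc hcγ _ _
  constructor
  · show ‖(c + s * ρ ^ k + ε * toyW ω k E) - (c + s * ρ ^ k + ε * toyW ω k E')‖ ≤ ε * ‖toyW ω k E - toyW ω k E'‖
    rw [show (c + s * ρ ^ k + ε * toyW ω k E) - (c + s * ρ ^ k + ε * toyW ω k E') = ε * (toyW ω k E - toyW ω k E') by ring,
      norm_mul, Real.norm_eq_abs, abs_of_nonneg hε]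
  · show |c * (1 + ε * toyW ω k E + s * ρ ^ k) - c * (1 + ε * toyW ω k E' + s * ρ ^ k)| ≤ γ * ε * ‖toyW ω k E - toyW ω k E'‖
    rw [show c * (1 + ε * toyW ω k E + s * ρ ^ k) - c * (1 + ε * toyW ω k E' + s * ρ ^ k) = (c * ε) * (toyW ω k E - toyW ω k E')
      by ring, abs_mul, Real.norm_eq_abs, abs_of_nonneg (mul_nonneg hc.le hε)]
    exact mul_le_mul_of_nonneg_right (mul_le_mul_of_nonneg_right hcγ hε) (abs_nonneg _)

/-- The geometric content of the constant sequence: `acc ω 1 k ≤ 1/(1 − ω)` for `0 ≤ ω < 1`. [folklore] -/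
theorem acc_one_le (hω : 0 ≤ ω) (hω1 : ω < 1) (k : ℕ) : acc ω (fun _ => (1 : ℝ)) k ≤ 1 / (1 - ω) := by
  have h := acc_pow_le (ν := ω) (θ := 1) hω hω1 k
  simpa using h

/-- The transfer of a family with entries of size `≤ E₀` is bounded by `E₀/(1 − ω)` (`0 ≤ ω < 1`, `0 ≤ E₀`). [folklore] -/
theorem toyW_le (hω : 0 ≤ ω) (hω1 : ω < 1) {E₀ : ℝ} (hE0 : 0 ≤ E₀) {k : ℕ} {E : Fin k → ℝ} (hE : ∀ j, ‖E j‖ ≤ E₀) :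
    |toyW ω k E| ≤ E₀ / (1 - ω) := by
  have h1 : |toyW ω k E| ≤ ∑ j : Fin k, ω ^ (k - 1 - (j : ℕ)) * ‖E j‖ := by
    rw [toyW_apply]
    refine (Finset.abs_sum_le_sum_abs _ _).trans (le_of_eq (Finset.sum_congr rfl fun j _ => ?_))
    rw [abs_mul, abs_of_nonneg (pow_nonneg hω _), Real.norm_eq_abs]
  have h2 : ∑ j : Fin k, ω ^ (k - 1 - (j : ℕ)) * ‖E j‖ ≤ ∑ j : Fin k, ω ^ (k - 1 - (j : ℕ)) * E₀ :=
    Finset.sum_le_sum fun j _ => mul_le_mul_of_nonneg_left (hE j) (pow_nonneg hω _)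
  have h3 : ∑ j : Fin k, ω ^ (k - 1 - (j : ℕ)) * E₀ = E₀ * acc ω (fun _ => (1 : ℝ)) k := by
    rw [sum_fin_weight_eq_acc ω (fun _ => E₀) k, ← acc_const_mul]; simp
  calc |toyW ω k E| ≤ E₀ * acc ω (fun _ => (1 : ℝ)) k := by rw [← h3]; exact h1.trans h2
    _ ≤ E₀ * (1 / (1 - ω)) := mul_le_mul_of_nonneg_left (acc_one_le hω hω1 k) hE0
    _ = E₀ / (1 - ω) := by ring

/-- L5 `CouplingLipschitz` with `ℓ′ = 1`, `ℓ = 1 + εE₀/(1 − ω) + s`. [folklore] -/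
theorem toy_couplingLipschitz (hω : 0 ≤ ω) (hω1 : ω < 1) (hε : 0 ≤ ε) (hs : 0 ≤ s) (hρ : 0 ≤ ρ) (hρ1 : ρ ≤ 1)
    {E₀ : ℝ} (hE0 : 0 ≤ E₀) (γ : ℝ) :
    (toyModel ω ε s ρ).CouplingLipschitz 1 (1 + ε * (E₀ / (1 - ω)) + s) E₀ γ := by
  intro k c c' E _ _ _ _ hE
  have ha : |toyW ω k E| ≤ E₀ / (1 - ω) := toyW_le hω hω1 hE0 hE
  have hρk : ρ ^ k ≤ 1 := pow_le_one₀ hρ hρ1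
  constructor
  · show ‖(c + s * ρ ^ k + ε * toyW ω k E) - (c' + s * ρ ^ k + ε * toyW ω k E)‖ ≤ 1 * |c - c'|
    rw [show (c + s * ρ ^ k + ε * toyW ω k E) - (c' + s * ρ ^ k + ε * toyW ω k E) = c - c' by ring, Real.norm_eq_abs, one_mul]
  · show |c * (1 + ε * toyW ω k E + s * ρ ^ k) - c' * (1 + ε * toyW ω k E + s * ρ ^ k)| ≤ (1 + ε * (E₀ / (1 - ω)) + s) * |c - c'|
    rw [show c * (1 + ε * toyW ω k E + s * ρ ^ k) - c' * (1 + ε * toyW ω k E + s * ρ ^ k)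
        = (c - c') * (1 + ε * toyW ω k E + s * ρ ^ k) by ring, abs_mul, mul_comm]
    refine mul_le_mul_of_nonneg_right ?_ (abs_nonneg _)
    calc |1 + ε * toyW ω k E + s * ρ ^ k| ≤ |1| + |ε * toyW ω k E| + |s * ρ ^ k| := abs_add_three _ _ _
      _ = 1 + ε * |toyW ω k E| + s * ρ ^ k := by
          rw [abs_one, abs_mul, abs_of_nonneg hε, abs_of_nonneg (mul_nonneg hs (pow_nonneg hρ _))]
      _ ≤ 1 + ε * (E₀ / (1 - ω)) + s * 1 := by gcongr
      _ = 1 + ε * (E₀ / (1 - ω)) + s := by ring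

/-- The admissibility level of the toy: `E₀ = (γ + s)(1 + ε/(1 − ν))`, `ν = ω + ε`. [folklore] -/
def toyE₀ (ω ε s γ : ℝ) : ℝ := (γ + s) * (1 + ε / (1 - (ω + ε)))

/-- L6 `Admissible` with `E₀ = toyE₀` (window `0 < γ`, `ν = ω + ε < 1`, `0 ≤ ρ ≤ 1`, `0 ≤ s`). [folklore] -/
theorem toy_admissible (hω : 0 ≤ ω) (hε : 0 ≤ ε) (hν : ω + ε < 1) (hs : 0 ≤ s) (hρ : 0 ≤ ρ) (hρ1 : ρ ≤ 1) (hγ : 0 < γ) :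
    (toyModel ω ε s ρ).Admissible (toyE₀ ω ε s γ) γ := by
  intro k g hg
  show ‖toyB ω ε s ρ k (prefixOf g k)‖ ≤ toyE₀ ω ε s γ
  have hν0 : 0 ≤ ω + ε := add_nonneg hω hε
  have hf : ∀ i, |g i + s * ρ ^ i| ≤ γ + s := by
    intro i
    have h1 : 0 < g i ∧ g i ≤ γ := hg i
    have h2 : 0 ≤ s * ρ ^ i := mul_nonneg hs (pow_nonneg hρ _)
    have h3 : s * ρ ^ i ≤ s := by simpa using mul_le_mul_of_nonneg_left (pow_le_one₀ hρ hρ1 (n := i)) hs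
    rw [abs_of_nonneg (by linarith)]; linarith
  have hacc : |acc (ω + ε) (fun i => g i + s * ρ ^ i) k| ≤ (γ + s) * (1 / (1 - (ω + ε))) := by
    calc |acc (ω + ε) (fun i => g i + s * ρ ^ i) k|
        ≤ acc (ω + ε) (fun i => |g i + s * ρ ^ i|) k := by
          unfold acc
          refine (Finset.abs_sum_le_sum_abs _ _).trans (le_of_eq ?_)
          refine Finset.sum_congr rfl fun m _ => ?_
          rw [abs_mul, abs_of_nonneg (pow_nonneg hν0 _)]
      _ ≤ acc (ω + ε) (fun _ => (γ + s) * 1) k := acc_le_acc hν0 (fun m => by simpa using hf m) k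
      _ = (γ + s) * acc (ω + ε) (fun _ => (1 : ℝ)) k := by rw [← acc_const_mul]
      _ ≤ (γ + s) * (1 / (1 - (ω + ε))) := mul_le_mul_of_nonneg_left (acc_one_le hν0 hν k) (by linarith)
  have hgk : |g k| ≤ γ := by rw [abs_of_pos (hg k).1]; exact (hg k).2
  have hsk : |s * ρ ^ k| ≤ s := by
    rw [abs_of_nonneg (mul_nonneg hs (pow_nonneg hρ _))]
    simpa using mul_le_mul_of_nonneg_left (pow_le_one₀ hρ hρ1 (n := k)) hs
  rw [Real.norm_eq_abs, toyB, toyA_prefixOf]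
  simp only [prefixOf_apply, Fin.val_last]
  calc |g k + s * ρ ^ k + ε * acc (ω + ε) (fun i => g i + s * ρ ^ i) k|
      ≤ |g k| + |s * ρ ^ k| + |ε * acc (ω + ε) (fun i => g i + s * ρ ^ i) k| := abs_add_three _ _ _
    _ ≤ γ + s + ε * ((γ + s) * (1 / (1 - (ω + ε)))) := by
        rw [abs_mul ε, abs_of_nonneg hε]
        exact add_le_add (add_le_add hgk hsk) (mul_le_mul_of_nonneg_left hacc hε)
    _ = toyE₀ ω ε s γ := by unfold toyE₀; ring

/-- The padded family transfers like the unpadded one: `W (k+1) (vecCons 0 E) = W k E` (the silent oldest slot carries weight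
`ω^k·0`). [folklore] -/
theorem toyW_cons (ω : ℝ) (k : ℕ) (E : Fin k → ℝ) : toyW ω (k + 1) (Matrix.vecCons 0 E) = toyW ω k E := by
  rw [toyW_apply, toyW_apply, Fin.sum_univ_succ]
  simp only [Matrix.cons_val_zero, mul_zero, zero_add, Matrix.cons_val_succ, Fin.val_succ]
  refine Finset.sum_congr rfl fun m _ => ?_
  have : k + 1 - 1 - ((m : ℕ) + 1) = k - 1 - (m : ℕ) := by omega
  rw [this]

/-- L7 `StepScaleShift` with `b = s(1 − ρ)`, `b_r = γs(1 − ρ)` (the toy's one-step η-source is the depth term `sρ^k`). [folklore] -/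
theorem toy_stepScaleShift (hs : 0 ≤ s) (hρ : 0 ≤ ρ) (hρ1 : ρ ≤ 1) (E₀ : ℝ) :
    (toyModel ω ε s ρ).StepScaleShift (s * (1 - ρ)) (γ * (s * (1 - ρ))) ρ E₀ γ := by
  intro k c E hc hcγ _
  have hW : toyW ω (k + 1) (Matrix.vecCons 0 E) = toyW ω k E := toyW_cons ω k E
  have hd : |s * ρ ^ (k + 1) - s * ρ ^ k| = s * (1 - ρ) * ρ ^ k := by
    rw [show s * ρ ^ (k + 1) - s * ρ ^ k = -(s * (1 - ρ) * ρ ^ k) by ring, abs_neg,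
      abs_of_nonneg (mul_nonneg (mul_nonneg hs (sub_nonneg.mpr hρ1)) (pow_nonneg hρ _))]
  constructor
  · show ‖(c + s * ρ ^ (k + 1) + ε * toyW ω (k + 1) (Matrix.vecCons 0 E)) - (c + s * ρ ^ k + ε * toyW ω k E)‖ ≤ _
    rw [hW, show (c + s * ρ ^ (k + 1) + ε * toyW ω k E) - (c + s * ρ ^ k + ε * toyW ω k E) = s * ρ ^ (k + 1) - s * ρ ^ k
      by ring, Real.norm_eq_abs, hd]
  · show |c * (1 + ε * toyW ω (k + 1) (Matrix.vecCons 0 E) + s * ρ ^ (k + 1)) - c * (1 + ε * toyW ω k E + s * ρ ^ k)| ≤ _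
    rw [hW, show c * (1 + ε * toyW ω k E + s * ρ ^ (k + 1)) - c * (1 + ε * toyW ω k E + s * ρ ^ k)
      = c * (s * ρ ^ (k + 1) - s * ρ ^ k) by ring, abs_mul, hd, abs_of_pos hc]
    have h := mul_le_mul_of_nonneg_right hcγ (mul_nonneg (mul_nonneg hs (sub_nonneg.mpr hρ1)) (pow_nonneg hρ k))
    calc c * (s * (1 - ρ) * ρ ^ k) ≤ γ * (s * (1 - ρ) * ρ ^ k) := h
      _ = γ * (s * (1 - ρ)) * ρ ^ k := by ring

end Leaves

/-! ## §4 Non-degeneracy and the END face applied to the toy -/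

/-- NON-DEGENERACY: the toy's β at depth 1 genuinely depends on the OLDER coupling — `β 1 (a, c) − β 1 (b, c) = c·ε·(a − b)` —
so for `cε ≠ 0` the family is NOT last-only/Markov (the regime where `FadingMemory` is trivial). [folklore] -/
theorem toyBeta_depends_on_history (ω ε s ρ binf c₀ θ a b c : ℝ) :
    toyBeta ω ε s ρ binf c₀ θ 1 ![a, c] - toyBeta ω ε s ρ binf c₀ θ 1 ![b, c] = c * ε * (a - b) := by
  simp [toyBeta, toyA]
  ring

/-- **THE END FACE IS INHABITED (kernel):** for `0 < ω`, `0 < ε`, `ω + ε < θ ≤ 1`, `0 ≤ ρ ≤ θ`, `0 ≤ s`, `0 < γ`, `0 ≤ c₀`, file 2's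
`ne4Triple_of_model` APPLIES to the toy and yields node U2's triple for `toyBeta` with memory rate EXACTLY `ω + ε`:
`ScaleShiftRate c θ γ β ∧ HistLipschitz Λ γ β ∧ FadingMemory C (ω + ε) Λ` for explicit `c, C, Λ` (here packaged existentially).
[folklore] -/
theorem toy_ne4Triple {ω ε s ρ γ θ binf c₀ : ℝ} (hω : 0 < ω) (hε : 0 < ε) (hνθ : ω + ε < θ) (hθ1 : θ ≤ 1)
    (hρ : 0 ≤ ρ) (hρθ : ρ ≤ θ) (hs : 0 ≤ s) (hγ : 0 < γ) (hc₀ : 0 ≤ c₀) :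
    ∃ c C : ℝ, ∃ Λ : ℕ → ℕ → ℝ,
      ScaleShiftRate c θ γ (toyBeta ω ε s ρ binf c₀ θ) ∧ HistLipschitz Λ γ (toyBeta ω ε s ρ binf c₀ θ) ∧
        T4CouplingMatching.FadingMemory C (ω + ε) Λ := by
  have hω1 : ω < 1 := by linarith
  have hν1 : ω + ε < 1 := by linarith
  have hρ1 : ρ ≤ 1 := hρθ.trans hθ1
  have hθ0 : 0 ≤ θ := hρ.trans hρθ
  have hE0 : 0 ≤ toyE₀ ω ε s γ := by
    unfold toyE₀
    have : 0 < 1 - (ω + ε) := by linarith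
    positivity
  have hconv : ∀ k, |(toySplit ω ε s ρ binf c₀ θ).β0 k - binf| ≤ c₀ * θ ^ k := by
    intro k
    show |binf + c₀ * θ ^ k - binf| ≤ c₀ * θ ^ k
    rw [show binf + c₀ * θ ^ k - binf = c₀ * θ ^ k by ring, abs_of_nonneg (mul_nonneg hc₀ (pow_nonneg hθ0 _))]
  have h := ne4Triple_of_model (toySplit ω ε s ρ binf c₀ θ) (toyModel ω ε s ρ)
    (toy_represents ω ε s ρ γ) (toy_readsRemainder ω ε s ρ γ binf c₀ θ) (toy_transferBound hω.le γ)
    (toy_activityLipschitz hε.le (toyE₀ ω ε s γ))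
    (toy_couplingLipschitz hω.le hω1 hε.le hs hρ hρ1 hE0 γ) (toy_admissible hω.le hε.le hν1 hs hρ hρ1 hγ)
    (toy_stepScaleShift hs hρ hρ1 (toyE₀ ω ε s γ)) hε.le (mul_nonneg hγ.le hε.le) zero_le_one hE0
    (by positivity) zero_le_one hω (mul_nonneg hs (sub_nonneg.mpr hρ1)) (mul_nonneg hγ.le (mul_nonneg hs (sub_nonneg.mpr hρ1)))
    hρ hρθ
    (by simpa using hνθ) hθ1 hc₀ hconv
  simp only [mul_one] at h
  exact ⟨_, _, _, h⟩

/-! ## §5 (v1.1) The memory rate `ν = ω + ε` is ATTAINED at the level of β — the route's window is load-bearing -/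

section Sharp

variable {ω ε s ρ binf c₀ θ : ℝ}
/-- Changing ONE older coupling: with `w' = w` except `w'_i = a` (`i < k`), the toy's activity changes by exactly
`ν^{k−1−i}(w_i − a)`. [folklore] -/
theorem toyA_update (ω ε s ρ : ℝ) {k : ℕ} (w : Fin (k + 1) → ℝ) (i : Fin k) (a : ℝ) :
    toyA ω ε s ρ k w - toyA ω ε s ρ k (Function.update w (Fin.castSucc i) a)
      = (ω + ε) ^ (k - 1 - (i : ℕ)) * (w (Fin.castSucc i) - a) := by
  unfold toyA
  rw [← Finset.sum_sub_distrib]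
  rw [Finset.sum_eq_single i]
  · simp
    ring
  · intro j _ hji
    have hne : Fin.castSucc j ≠ Fin.castSucc i := fun h => hji (Fin.castSucc_injective _ h)
    simp [Function.update_of_ne hne]
  · intro hi; exact absurd (Finset.mem_univ i) hi

/-- EXACT RESPONSE OF THE TOY'S β TO ONE OLDER COUPLING (kernel): `β k w − β k w' = w_k·ε·ν^{k−1−i}·(w_i − w'_i)` when
`w, w'` differ only in the coordinate `i < k` — the modulus in `g_i` is EXACTLY `w_k ε ν^{k−1−i}`, `ν = ω + ε`. [folklore] -/
theorem toyBeta_update (ω ε s ρ binf c₀ θ : ℝ) {k : ℕ} (w : Fin (k + 1) → ℝ) (i : Fin k) (a : ℝ) :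
    toyBeta ω ε s ρ binf c₀ θ k w - toyBeta ω ε s ρ binf c₀ θ k (Function.update w (Fin.castSucc i) a)
      = w (Fin.last k) * ε * (ω + ε) ^ (k - 1 - (i : ℕ)) * (w (Fin.castSucc i) - a) := by
  have hlast : Function.update w (Fin.castSucc i) a (Fin.last k) = w (Fin.last k) :=
    Function.update_of_ne (Fin.castSucc_lt_last i).ne' _ _
  have hA := toyA_update ω ε s ρ w i a
  simp only [toyBeta, hlast]
  have : toyA ω ε s ρ k (Function.update w (Fin.castSucc i) a)
      = toyA ω ε s ρ k w - (ω + ε) ^ (k - 1 - (i : ℕ)) * (w (Fin.castSucc i) - a) := by linarith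
  rw [this]; ring

/-- LOWER BOUND ON ANY HISTORY MODULI of the toy's β (kernel): if `HistLipschitz Λ γ (toyBeta …)` then
`γ·ε·ν^{k−1−i} ≤ Λ k i` for every `i < k` (`0 < γ`, `0 ≤ ε`, `0 ≤ ω`): test histories `p ≡ γ` and `p` with `g_i` halved.
[folklore] -/
theorem toy_moduli_lower {γ : ℝ} (hγ : 0 < γ) (hε : 0 ≤ ε) (hω : 0 ≤ ω) {Λ : ℕ → ℕ → ℝ}
    (hΛ : HistLipschitz Λ γ (toyBeta ω ε s ρ binf c₀ θ)) (k : ℕ) (i : Fin k) :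
    γ * ε * (ω + ε) ^ (k - 1 - (i : ℕ)) ≤ Λ k i := by
  set p : Fin (k + 1) → ℝ := fun _ => γ with hp
  set q : Fin (k + 1) → ℝ := Function.update p (Fin.castSucc i) (γ / 2) with hq
  have hpB : p ∈ Box γ k := mem_box.mpr fun _ => ⟨hγ, le_rfl⟩
  have hqB : q ∈ Box γ k := by
    refine mem_box.mpr fun j => ?_
    by_cases hj : j = Fin.castSucc i
    · subst hj; simp [hq]; constructor <;> linarith
    · simp [hq, Function.update_of_ne hj, hp, hγ]
  have h := hΛ k p q hpB hqB
  have hpi : p (Fin.castSucc i) = γ := rfl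
  have hqi : q (Fin.castSucc i) = γ / 2 := by simp [hq]
  have hlhs : toyBeta ω ε s ρ binf c₀ θ k p - toyBeta ω ε s ρ binf c₀ θ k q
      = γ * ε * (ω + ε) ^ (k - 1 - (i : ℕ)) * (γ / 2) := by
    rw [hq, toyBeta_update]; ring
  have hrhs : ∑ j : Fin (k + 1), Λ k j * |p j - q j| = Λ k i * (γ / 2) := by
    rw [Finset.sum_eq_single (Fin.castSucc i)]
    · rw [hqi, hpi, Fin.val_castSucc, show γ - γ / 2 = γ / 2 by ring, abs_of_pos (by linarith)]
    · intro j _ hj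
      have : q j = p j := by rw [hq, Function.update_of_ne hj]
      rw [this, sub_self, abs_zero, mul_zero]
    · intro hi; exact absurd (Finset.mem_univ _) hi
  rw [hlhs, hrhs, abs_of_nonneg (by positivity)] at h
  nlinarith

/-- **THE WINDOW IS LOAD-BEARING AT THE LEVEL OF β (kernel): NO FADING MEMORY BELOW `ν = ω + ε`.**  For the toy
(`0 < γ`, `0 < ε`, `0 ≤ ω`), any history moduli `Λ` of its β (`HistLipschitz Λ γ β`) and any rate `θ < ω + ε`,
`¬ FadingMemory C θ Λ` — the rate `ν` of file 1's `fadingMemory_moduli` is attained, so the route's smallness `ν < 1` cannot be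
weakened inside the model class (compare `T4BetaMemorySharp.not_fadingMemory_below` for the majorants). [folklore] -/
theorem toy_not_fadingMemory_below {γ : ℝ} (hγ : 0 < γ) (hε : 0 < ε) (hω : 0 ≤ ω) {Λ : ℕ → ℕ → ℝ}
    (hΛ : HistLipschitz Λ γ (toyBeta ω ε s ρ binf c₀ θ)) {C ϑ : ℝ} (hϑ0 : 0 ≤ ϑ) (hϑν : ϑ < ω + ε) :
    ¬ T4CouplingMatching.FadingMemory C ϑ Λ := by
  intro hF
  have hν : 0 < ω + ε := by linarith
  -- the lower bound at age k − 1 (coupling g₀ seen from step k): γε ν^{k−1} ≤ Λ k 0 ≤ C ϑ^k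
  have hcmp : ∀ n : ℕ, γ * ε * (ω + ε) ^ n ≤ C * ϑ ^ (n + 1) := by
    intro n
    have h1 := toy_moduli_lower (s := s) (ρ := ρ) (binf := binf) (c₀ := c₀) (θ := θ) hγ hε.le hω hΛ (n + 1) ⟨0, Nat.succ_pos n⟩
    have h2 := (hF (n + 1) 0 (Nat.zero_le _)).2
    simp only [Nat.add_sub_cancel, Nat.sub_zero] at h1 h2
    exact h1.trans h2
  rcases eq_or_lt_of_le hϑ0 with hϑ | hϑ
  · -- ϑ = 0: already n = 0 fails
    have h := hcmp 0
    rw [← hϑ] at h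
    simp at h
    nlinarith [mul_pos hγ hε]
  · -- ϑ > 0: (ν/ϑ)^n is unbounded
    have hr : 1 < (ω + ε) / ϑ := (one_lt_div hϑ).mpr hϑν
    have hbound : ∀ n : ℕ, ((ω + ε) / ϑ) ^ n ≤ C * ϑ / (γ * ε) := by
      intro n
      have h := hcmp n
      rw [div_pow, div_le_div_iff₀ (pow_pos hϑ n) (mul_pos hγ hε)]
      calc (ω + ε) ^ n * (γ * ε) = γ * ε * (ω + ε) ^ n := by ring
        _ ≤ C * ϑ ^ (n + 1) := h
        _ = C * ϑ * ϑ ^ n := by ring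
    obtain ⟨n, hn⟩ := ((tendsto_pow_atTop_atTop_of_one_lt hr).eventually_gt_atTop (C * ϑ / (γ * ε))).exists
    exact absurd (hbound n) (not_le.mpr hn)

end Sharp
end Summit.QuantumFields.BalabanUV.T4Continuum.NE4TransferResolventWitness
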